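import Summits.MatrixMultiplication.MatrixMultiplication.Theorems.NilpotentLieHostsUnitriangularCostShapeModelWeights

/-!
# `UnitriangularCostShape` — Product model, part 9: the span theorem

Crux `stmt-MatrixMultiplication-7724` (`NilpotentLieHosts.UnitriangularCostShape`), line `registered`
(`Cruxes/UnitriangularCostShape/Lines/birth.lean`), stub `stub_productModel` (the Weyl-type product model of
`U(u_d)/I^(s+1)` over the truncated Casimir algebra, `b = k = ⌊d/2⌋`).  Helper vocabulary and lemmas, namespace
`…Theorems.UnitriangularCostShape.ProductModel`.

`main_span`: every monomial in the upper block of column `j` of weight `< K` is a `ℂ`-combination of slices with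
data in columns `≤ j` and weights `≤ (d-1) · weight` (double induction: level, then row-degree).
-/

set_option linter.dupNamespace false

noncomputable section

namespace Summit.MatrixMultiplication.MatrixMultiplication.Theorems.UnitriangularCostShape.ProductModel

open MvPolynomial
open scoped BigOperators Pointwise

variable {d : ℕ}

/-- Generators: slices `U_K(γ, α)` with `α` on `q`-variables, data in columns `≤ jb`, weights
`≤ (d-1) w`. -/
def Gens (K jb w : ℕ) : Set (A d) :=
  {f | ∃ α γ : Var d →₀ ℕ, (∀ u ∈ α.support, (u.col : ℕ) ≤ jb ∧ d ≤ (u.row : ℕ) + u.col) ∧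
    (∀ u ∈ γ.support, (u.col : ℕ) ≤ jb) ∧ Finsupp.weight Var.wt α ≤ (d - 1) * w ∧
    Finsupp.weight Var.wt γ ≤ (d - 1) * w ∧ f = Slice K α γ}

/-- The generating sets are monotone in the column bound and the budget. -/
theorem gens_mono (K : ℕ) {jb jb' w w' : ℕ} (hj : jb ≤ jb') (hw : w ≤ w') :
    Gens (d := d) K jb w ⊆ Gens K jb' w' := by
  rintro f ⟨α, γ, h1, h2, h3, h4, rfl⟩
  exact ⟨α, γ, fun u hu => ⟨(h1 u hu).1.trans hj, (h1 u hu).2⟩, fun u hu => (h2 u hu).trans hj,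
    h3.trans (Nat.mul_le_mul_left _ hw), h4.trans (Nat.mul_le_mul_left _ hw), rfl⟩

/-- `1` is in the span of the generators. -/
theorem one_mem_span_gens {K : ℕ} (hK : 1 ≤ K) (jb w : ℕ) :
    (1 : A d) ∈ Submodule.span ℂ (Gens K jb w) :=
  Submodule.subset_span ⟨0, 0, by simp, by simp, by simp, by simp, (Slice_zero_zero hK).symm⟩

/-- Multiplying a combination of deeper slices by the level-`j` coefficient stays in the span. -/
theorem level_mul_mem_span {K : ℕ} (hK : 1 ≤ K) (j : Fin d) (hj : d ≤ 2 * (j : ℕ))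
    (β : Fin d × Fin d →₀ ℕ) (hKβ : ∀ p, β p < K) (jb w' : ℕ) (hjb : jb < j) {f : A d}
    (hf : f ∈ Submodule.span ℂ (Gens K jb w')) :
    coeff (gamL j β) (EL K j * sigma (Xmat d) (monomial (epsL j β) 1)) * f ∈
      Submodule.span ℂ (Gens K j (Finsupp.weight xw (shellL j β) + w')) := by
  induction hf using Submodule.span_induction with
  | mem g hg =>
    obtain ⟨α', γ', hα', hγ', hwα, hwγ, rfl⟩ := hg
    have hα'' : ∀ u ∈ α'.support, ¬ u.col = j := by
      intro u hu h
      have := (hα' u hu).1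
      rw [h] at this
      omega
    have hγ'' : ∀ u ∈ γ'.support, ¬ u.col = j := by
      intro u hu h
      have := hγ' u hu
      rw [h] at this
      omega
    rw [level_mul_slice hK j hj β α' γ' hα'' hγ'']
    refine Submodule.subset_span ⟨epsL j β + α', gamL j β + γ', ?_, ?_, ?_, ?_, rfl⟩
    · intro u hu
      rcases Finset.mem_union.mp (Finsupp.support_add hu) with h | h
      · rw [Finsupp.mem_support_iff, epsL_apply] at h
        by_cases hc : u.col = j ∧ lo j < u.row
        · refine ⟨le_of_eq (by rw [hc.1]), ?_⟩
          have h1 : (lo j : ℕ) < u.row := hc.2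
          rw [lo_val] at h1
          have h2 := hc.1
          have h3 : (u.col : ℕ) = j := by rw [h2]
          omega
        · exact absurd (if_neg hc) h
      · exact ⟨(hα' u h).1.trans hjb.le, (hα' u h).2⟩
    · intro u hu
      rcases Finset.mem_union.mp (Finsupp.support_add hu) with h | h
      · rw [Finsupp.mem_support_iff, gamL_apply] at h
        by_cases hc : u.col = j
        · exact le_of_eq (by rw [hc])
        · exact absurd (if_neg hc) h
      · exact (hγ' u h).trans hjb.le
    · rw [map_add, mul_add]
      refine Nat.add_le_add ((weight_epsL_le j β).trans (Nat.mul_le_mul_right _ (by omega))) hwα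
    · rw [map_add, mul_add]
      exact Nat.add_le_add (weight_gamL_le K j hj β hKβ) hwγ
  | zero => rw [mul_zero]; exact Submodule.zero_mem _
  | add x y _ _ hx hy => rw [mul_add]; exact Submodule.add_mem _ hx hy
  | smul c x _ hx => rw [mul_smul_comm]; exact Submodule.smul_mem _ c hx

/-- Entries of an upper-supported exponent are bounded by its weight. -/
theorem apply_le_weight_xw (β : Fin d × Fin d →₀ ℕ) (hβ : ∀ p ∈ β.support, p.1 < p.2) (p : Fin d × Fin d) :
    β p ≤ Finsupp.weight xw β := by
  by_cases h : β p = 0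
  · rw [h]; exact Nat.zero_le _
  · refine Finsupp.le_weight xw ?_ β
    have := hβ p (Finsupp.mem_support_iff.mpr h)
    unfold xw
    have h' : (p.1 : ℕ) < p.2 := this
    omega

/-- The shell has the same row-degree as `β`. -/
theorem rhoL_shellL (j : Fin d) (β : Fin d × Fin d →₀ ℕ)
    (hβ : ∀ p ∈ β.support, lo j ≤ p.1 ∧ p.1 < p.2 ∧ p.2 ≤ j) :
    rhoL j (shellL j β) = rhoL j β := by
  conv_rhs => rw [← shellL_add_innerL j β hβ]
  rw [rhoL_add, rhoL_innerL, add_zero]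

/-- **Span theorem.** Every monomial supported in the upper block of column `j` with weight `< K`
is a `ℂ`-combination of slices with data in columns `≤ j` and weights `≤ (d-1) · weight`. -/
theorem main_span {K : ℕ} (hK : 1 ≤ K) (j : ℕ) : ∀ (hjd : j < d) (β : Fin d × Fin d →₀ ℕ),
    (∀ p ∈ β.support, (lo ⟨j, hjd⟩ : Fin d) ≤ p.1 ∧ p.1 < p.2 ∧ p.2 ≤ (⟨j, hjd⟩ : Fin d)) →
    Finsupp.weight xw β < K →
    (monomial β (1 : ℂ) : A d) ∈ Submodule.span ℂ (Gens K j (Finsupp.weight xw β)) := by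
  classical
  induction j with
  | zero =>
    intro hjd β hβ _
    have : β = 0 := by
      ext p
      by_contra h
      obtain ⟨_, h2, h3⟩ := hβ p (Finsupp.mem_support_iff.mpr h)
      have h2' : (p.1 : ℕ) < p.2 := h2
      have h3' : (p.2 : ℕ) ≤ 0 := h3
      omega
    subst this
    simpa using one_mem_span_gens (d := d) hK 0 0
  | succ j ih =>
    intro hjd β hβ hKβ
    by_cases hlev : d ≤ 2 * (j + 1)
    swap
    · have : β = 0 := by
        ext p
        by_contra h
        obtain ⟨h1, h2, h3⟩ := hβ p (Finsupp.mem_support_iff.mpr h)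
        have h1' : ((lo (⟨j + 1, hjd⟩ : Fin d) : Fin d) : ℕ) ≤ p.1 := h1
        have h2' : (p.1 : ℕ) < p.2 := h2
        have h3' : (p.2 : ℕ) ≤ j + 1 := h3
        rw [lo_val] at h1'
        simp only at h1'
        omega
      subst this
      simpa using one_mem_span_gens (d := d) hK (j + 1) 0
    -- a genuine level `jF = j + 1`
    set jF : Fin d := ⟨j + 1, hjd⟩ with hjF
    have hlev' : d ≤ 2 * (jF : ℕ) := hlev
    suffices H : ∀ n (β : Fin d × Fin d →₀ ℕ),
        (∀ p ∈ β.support, lo jF ≤ p.1 ∧ p.1 < p.2 ∧ p.2 ≤ jF) → Finsupp.weight xw β < K →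
        rhoL jF β < n → (monomial β (1 : ℂ) : A d) ∈ Submodule.span ℂ (Gens K (j + 1) (Finsupp.weight xw β)) from
      H _ β hβ hKβ (Nat.lt_succ_self _)
    intro n
    induction n with
    | zero => intro β _ _ h; exact absurd h (Nat.not_lt_zero _)
    | succ n ihn =>
      intro β hβ hKβ hρ
      have hdec := shellL_add_innerL jF β hβ
      have hwdec : Finsupp.weight xw (shellL jF β) + Finsupp.weight xw (innerL jF β) =
          Finsupp.weight xw β := by rw [← map_add, hdec]
      have hin := innerL_support jF β hβ
      have hjd' : j < d := Nat.lt_of_succ_lt hjd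
      -- the inner part, by the outer induction hypothesis
      have hinner : (monomial (innerL jF β) (1 : ℂ) : A d) ∈
          Submodule.span ℂ (Gens K j (Finsupp.weight xw (innerL jF β))) := by
        refine ih hjd' _ (fun p hp => ?_) (lt_of_le_of_lt (by omega) hKβ)
        obtain ⟨h1, h2, h3⟩ := hin p hp
        have h1' : ((lo jF : Fin d) : ℕ) < p.1 := h1
        rw [lo_val] at h1'
        refine ⟨?_, h2, ?_⟩
        · show ((lo (⟨j, hjd'⟩ : Fin d) : Fin d) : ℕ) ≤ p.1
          rw [lo_val]; simp only [hjF] at h1' ⊢; omega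
        · show (p.2 : ℕ) ≤ j
          simp only [hjF] at h3; omega
      have hKp : ∀ p, β p < K := fun p =>
        lt_of_le_of_lt (apply_le_weight_xw β (fun p hp => (hβ p hp).2.1) p) hKβ
      obtain ⟨N, hN, hN'⟩ := level_structure K jF hlev' β hKp
      have hprod := level_mul_mem_span hK jF hlev' β hKp j (Finsupp.weight xw (innerL jF β))
        (by simp [hjF]) hinner
      rw [hN, add_mul, hwdec, mul_assoc, monomial_mul, one_mul, hdec] at hprod
      -- the correction terms are in the span by the inner induction hypothesis
      have hNmem : N * monomial (innerL jF β) 1 ∈ Submodule.span ℂ (Gens K (j + 1) (Finsupp.weight xw β)) := by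
        rw [N.as_sum, Finset.sum_mul]
        refine Submodule.sum_mem _ fun b hb => ?_
        rw [monomial_mul, mul_one, ← mul_one (coeff b N), ← smul_eq_mul, ← smul_monomial]
        refine Submodule.smul_mem _ _ ?_
        -- `b` lies in the joint support of the level product
        have hbne : b ≠ shellL jF β := by
          intro h
          have := hN' b hb
          rw [h, rhoL_shellL jF β hβ] at this
          exact lt_irrefl _ this
        have hbJ : (b, gamL jF β) ∈ JSupp (EL K jF * sigma (Xmat d) (monomial (epsL jF β) 1)) := by
          rw [mem_jsupp]
          simp only
          rw [hN, coeff_add, IsScalarTower.algebraMap_apply ℚ ℂ (A d), MvPolynomial.algebraMap_eq,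
            C_mul_monomial, mul_one, coeff_monomial, if_neg (Ne.symm hbne), zero_add]
          exact MvPolynomial.mem_support_iff.mp hb
        obtain ⟨hbal, hblk, -, -⟩ := jsupp_level K jF hlev' β hbJ
        simp only at hbal hblk
        have hwb : Finsupp.weight xw b = Finsupp.weight xw (shellL jF β) := by
          have := weight_shellL_add K jF hlev' β hKp
          omega
        have hw' : Finsupp.weight xw (b + innerL jF β) = Finsupp.weight xw β := by
          rw [map_add, hwb, hwdec]
        have := ihn (b + innerL jF β) ?_ (by rw [hw']; exact hKβ) ?_
        · rwa [hw'] at this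
        · intro p hp
          rcases Finset.mem_union.mp (Finsupp.support_add hp) with h | h
          · exact hblk p h
          · have hsub : p ∈ β.support := by
              rw [innerL, Finsupp.support_filter] at h
              exact (Finset.mem_filter.mp h).1
            exact hβ p hsub
        · rw [rhoL_add, rhoL_innerL, add_zero]
          exact lt_of_lt_of_le (hN' b hb) (Nat.lt_succ_iff.mp hρ)
      have hcmono : algebraMap ℚ (A d) (∏ u ∈ LV jF, ((β (u.row, jF)).factorial : ℚ)⁻¹) * monomial β 1 ∈
          Submodule.span ℂ (Gens K (j + 1) (Finsupp.weight xw β)) := by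
        have := Submodule.sub_mem _ hprod hNmem
        rwa [add_sub_cancel_right] at this
      -- divide by the nonzero constant
      set c : ℚ := ∏ u ∈ LV jF, ((β (u.row, jF)).factorial : ℚ)⁻¹ with hc
      have hc0 : (algebraMap ℚ ℂ c) ≠ 0 := by
        rw [map_ne_zero_iff _ (algebraMap ℚ ℂ).injective]
        exact Finset.prod_ne_zero_iff.mpr fun u _ => inv_ne_zero (Nat.cast_ne_zero.mpr (Nat.factorial_ne_zero _))
      have e2 : (monomial β (1 : ℂ) : A d) =
          (algebraMap ℚ ℂ c)⁻¹ • (algebraMap ℚ (A d) c * monomial β 1) := by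
        rw [IsScalarTower.algebraMap_apply ℚ ℂ (A d), ← Algebra.smul_def, smul_smul, inv_mul_cancel₀ hc0,
          one_smul]
      rw [e2]
      exact Submodule.smul_mem _ _ hcmono

/-- Landing hook of part 9: the span theorem. -/
theorem stub_pm_span : ∀ (d K : ℕ), 1 ≤ K → ∀ (j : ℕ) (hjd : j < d) (β : Fin d × Fin d →₀ ℕ), (∀ p ∈ β.support, (lo ⟨j, hjd⟩ : Fin d) ≤ p.1 ∧ p.1 < p.2 ∧ p.2 ≤ (⟨j, hjd⟩ : Fin d)) → Finsupp.weight xw β < K → (MvPolynomial.monomial β (1 : ℂ) : A d) ∈ Submodule.span ℂ (Gens K j (Finsupp.weight xw β)) :=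
  fun _ _ hK j hjd β hβ hw => main_span hK j hjd β hβ hw

end Summit.MatrixMultiplication.MatrixMultiplication.Theorems.UnitriangularCostShape.ProductModel
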